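import Summits.BirchSwinnertonDyer.Rank1Residual.X5.TwoAdicTargetsSplitGS
import Summits.BirchSwinnertonDyer.Rank1Residual.X5.TwoAdicTargetsMultPub
import HarnessLib

/-!
# Class O1 (X5, `p = 2`, non-CM): the rank-`0` `2`-CONVERSE at a MULTIPLICATIVE `2` — the LOWER
# (Eisenstein-side) `⊗ℚ` divisibility TYPED (T-mult-4), and «`Sel_{2^∞}(E/ℚ)` finite ⇒ `r_an = 0`»
# assembled from it (PROVED), the split branch using the Greenberg–Stevens formula at `2`

HONEST FRAMING (cell `bsd-2adic`, run/shared/lean/pub/bsd-2adic/, FULL-BSD rank ≤ 1 programme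
tranche 1b, D-0036; seat `bsd-2adic-mult`, GEN 2): research routes; no claim beyond the stated
classes; nothing here is booked; no mark of RESIDUAL-MAP §I moves. ONE typed target
(`@[conjecture] def`, nothing asserted) + bookkeeping theorems; 0 named facts. The cell's head line
(README, D-0036) asks every target in BOTH forms — BSD₂ and the rank-`0`/`1` `2`-CONVERSE
«`corank_{ℤ₂} Sel_{2^∞}(E/ℚ) = r ⇒ r_an = r`»; the multiplicative-at-`2` BSD₂ doors are in
`X5/TwoAdicTargets{MultAuto,SplitAuto,MultKatoRat,SplitGS}.lean`; this file is the `r = 0` converse.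

* **`O1.MultLowerDivisibilityAtTwoRat W` (`@[conjecture]`, T-mult-4 of TARGET.md §1.3/§1.7)** — the
  OPPOSITE (Eisenstein / Skinner–Urban-side) `⊗ℚ` divisibility at a multiplicative `2`, both signs,
  in the tree's currency: for the cyclotomic datum, a newform `f` of `W` (any level), a dual datum
  `D` of `Sel_{2^∞}(E/ℚ_∞)` with `char_Λ X = (f_E)`: (non-split) for every `L` with
  `IsMultPAdicLFunctionOf f 2 (-1) L` there are `n` and `h ∈ Λ` with `2ⁿ · ι f_E = ι h · L`
  (`L ∣ 2ⁿ f_E` in `Λ ⊗ ℚ`); (split) for every `L` with `IsSplitMultPAdicLFunctionOf f 2 L`,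
  `2ⁿ · ι(T · f_E) = ι h · L` (`L ∣ 2ⁿ T f_E`: the trivial zero of `L` charged to the factor `T`).
  Together with K11a / K11b-Rat (Kato's direction, `HOME/mult/PROOF-MULT.md`) this is the `⊗ℚ` main
  conjecture at a multiplicative `2`. NOT IN PRINT at `p = 2` in any case (at odd `p ‖ N`: Skinner,
  Pacific J. Math. 283 (2016) Thm. A/B — `p ≥ 3`, (irr), (ram); Skinner–Urban 2014 Thm. 3.6.4 needs
  `p ∤ N`). A TARGET; nothing asserted; no proof is claimed by this seat.
* **`analyticRank_eq_zero_of_finite_selmer_nonsplit_two` (PROVED):** non-split `2`: `BSD₂`-free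
  rank-`0` converse `Finite Sel_{2^∞}(E/ℚ) ⇒ L(E,1) ≠ 0 ∧ r_an(E) = 0` ⟸ PRINT {Greenberg's non-split
  display A235 (`h41`), modularity} + K11a (`hK`, for `X` torsion; PROOF-MULT Thm. A) +
  `MultLowerDivisibilityAtTwoRat W`. Chain: `Sel` finite ⇒ (A235) `f_E(0) ≠ 0` ⇒ (T-mult-4)
  `L(0) ≠ 0` ⇒ `2·[0]⁺_f ≠ 0` ⇒ `L(E,1) ≠ 0`.
* **`analyticRank_eq_zero_of_finite_selmer_split_two` (PROVED):** split `2`: the same ⟸ PRINT {A236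
  (`h41`), modularity, Mahler–Manin} + K11b-Rat (`hK`) + `MultLowerDivisibilityAtTwoRat W` +
  **`greenberg_stevens W 2`** (the seat's `HOME/mult/PROOF-GS2.md`): `Sel` finite ⇒ (A236)
  `f_E(0) ≠ 0` ⇒ (T-mult-4, coefficient of `T¹`) `[T¹]L ≠ 0` ⇒ (GS at `2`) `𝓛₂(E)·[0]⁺_f ≠ 0` ⇒
  `L(E,1) ≠ 0`. At a split `2` the exceptional-zero formula is thus an INPUT of the converse.
* `hK` is K11a / K11b-Rat per `f` (the projections of the prime-uniform binder of
  `X5/TwoAdicTargetsMultKatoRat.lean`).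

References: [Skinner2016PacificMC] Thm. A/B (odd p; shape); [SkinnerUrban2014] Thm. 3.6.4 (p ∤ N);
[GreenbergLNM1716] §4 pp. 112–113; [Kobayashi2006DocMath] Cor. 4.2; [MazurTateTeitelbaum1986Invent]
§I.10, §I.14.
-/

set_option autoImplicit false

noncomputable section

open scoped Classical MatrixGroups ModularForm

open CongruenceSubgroup WeierstrassCurve Literature.NumberTheory.EllipticCurves
  Literature.NumberTheory.EllipticCurves.ModularForms
  Literature.NumberTheory.EllipticCurves.Greenberg1999
  Literature.NumberTheory.EllipticCurves.Rank1Residual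
  Literature.NumberTheory.EllipticCurves.Rank1Residual.Typed

namespace Summit.BirchSwinnertonDyer.Rank1Residual.X5.O1

variable (W : WeierstrassCurve ℚ) [W.IsElliptic] [W.IsGloballyMinimal]

/-! ## §1 T-mult-4: the lower (Eisenstein-side) `⊗ℚ` divisibility at a multiplicative `2` (TYPED) -/

/-- **T-mult-4 — the LOWER `⊗ℚ` divisibility at a prime `2` of MULTIPLICATIVE reduction, both signs.**
For `E/ℚ` (globally minimal `W`) with `2 ‖ N`, the cyclotomic `ℤ₂`-extension `κ` with generator `γ`
matching the cyclotomic variable, a newform `f` of `W` (any level) and a dual datum `D` of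
`Sel_{2^∞}(E/ℚ_∞)` with `char_Λ X = (f_E)`: (i) NON-split (`a₂ = -1`): for every `L` with
`IsMultPAdicLFunctionOf f 2 (-1) L`, `2ⁿ · ι f_E = ι h · L` for some `n` and `h ∈ Λ` — `L ∣ 2ⁿ·f_E` in
`Λ ⊗ ℚ`; (ii) SPLIT (`a₂ = 1`): for every `L` with `IsSplitMultPAdicLFunctionOf f 2 L`,
`2ⁿ · ι(T · f_E) = ι h · L` — `L ∣ 2ⁿ·T·f_E`, the trivial zero of `L` matched by the factor `T`
(Greenberg, LNM 1716 pp. 112–113: the classical `X` has `f_E(0) ≠ 0` in rank `0` at a split `p`).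
The Skinner–Urban / Eisenstein-congruence direction; with K11a / K11b-Rat it is the `⊗ℚ` cyclotomic
main conjecture at a multiplicative `2`. In print only at odd `p` under extra hypotheses
(Skinner 2016 Thm. A/B: `p ≥ 3`, `E[p]` irreducible, (ram)); NOT in print at `p = 2`. A TARGET;
nothing asserted. [cite: Skinner2016PacificMC, Thm. A and Thm. B (§1; p ≥ 3, (irr), (ram))]
[cite: GreenbergLNM1716, §4 pp. 112–113] [cite: MazurTateTeitelbaum1986Invent, §I.10, §I.14] -/
@[conjecture] def MultLowerDivisibilityAtTwoRat : Prop :=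
  ∀ (κ : ZpExtension ℚ 2) (γ : Field.absoluteGaloisGroup ℚ), κ.IsCyclotomic →
    κ.IsTopGenerator γ → IsCyclotomicVariable 2 γ → Mult W 2 →
    ∀ ⦃N : ℕ⦄ [NeZero N] (f : CuspForm (Gamma0 N) 2), IsNewformOf W f →
    ∀ (D : W.SelmerDualData κ γ) (fE : IwasawaAlgebra 2), D.charIdeal = Ideal.span {fE} →
      (¬ W.HasSplitMultiplicativeReductionAtPrime 2 →
        ∀ L : PowerSeries ℚ_[2], IsMultPAdicLFunctionOf f 2 (-1) L →
          ∃ (n : ℕ) (h : IwasawaAlgebra 2),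
            PowerSeries.C ((2 : ℚ_[2]) ^ n) * iwasawaToPowerSeries 2 fE =
              iwasawaToPowerSeries 2 h * L) ∧
      (W.HasSplitMultiplicativeReductionAtPrime 2 →
        ∀ L : PowerSeries ℚ_[2], IsSplitMultPAdicLFunctionOf f 2 L →
          ∃ (n : ℕ) (h : IwasawaAlgebra 2),
            PowerSeries.C ((2 : ℚ_[2]) ^ n) * iwasawaToPowerSeries 2 (PowerSeries.X * fE) =
              iwasawaToPowerSeries 2 h * L)

omit [W.IsElliptic] [W.IsGloballyMinimal] in
/-- Off the multiplicative locus the target holds VACUOUSLY (its guard `Mult W 2`). [folklore] -/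
theorem multLowerDivisibilityAtTwoRat_of_not_mult (h : ¬ Mult W 2) :
    MultLowerDivisibilityAtTwoRat W :=
  fun _ _ _ _ _ hm => absurd hm h

/-! ## §2 The rank-`0` `2`-converse at a NON-SPLIT `2` -/

/-- **Rank-`0` `2`-converse at a non-split multiplicative `2` (PROVED modulo the typed input).**
`E/ℚ` (globally minimal `W`) non-split multiplicative at `2`; inputs: Greenberg's non-split display at
`2` (`h41`, A235, PRINT), modularity (`hmod`, PRINT), K11a for the newform at level `N_E` (`hK`; the
seat's PROOF-MULT Thm. A — only `X` torsion is used), and T-mult-4 (`hlow'`). If `Sel_{2^∞}(E/ℚ)` is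
finite then `L(E,1) ≠ 0` and `r_an(E) = 0`: A235 gives
`f_E(0)·#E(ℚ)[2^∞]² = u·2^{ord₂∏c+1}·#Sel ≠ 0`, T-mult-4 gives `2ⁿ f_E(0) = h(0)·L(0)`, so
`L(0) = 2·[0]⁺_f ≠ 0`, i.e. `L(E,1) = [0]⁺_f·Ω⁺_f ≠ 0`. [cite: GreenbergLNM1716, §4 pp. 112–113]
[cite: MazurTateTeitelbaum1986Invent, §I.14 (L(0) = (1 − α⁻¹)[0]⁺, α = −1)] -/
theorem analyticRank_eq_zero_of_finite_selmer_nonsplit_two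
    (h41 : thm41Analogue_charValue_rankZero_numberField_anyPrime)
    (hmod : nonempty_modularParametrizationData)
    (hK : ∀ [NeZero (W.conductorNorm ℤ)] (f : CuspForm (Gamma0 (W.conductorNorm ℤ)) 2)
      (L : PowerSeries ℚ_[2]), KatoDivisibilityAtTwoNonsplitMultRat W f L)
    (hlow' : MultLowerDivisibilityAtTwoRat W)
    (hmult : Mult W 2) (hns : ¬ W.HasSplitMultiplicativeReductionAtPrime 2)
    (hfin : Finite (W.selmerGroupPInfty 2)) :
    W.entireLFunction 1 ≠ 0 ∧ W.analyticRank = 0 := by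
  haveI : NeZero (W.conductorNorm ℤ) := ⟨(W.conductorNorm_pos_holds).ne'⟩
  obtain ⟨Dm⟩ := hmod W
  have hf : IsNewformOf W Dm.f := Dm.isNewformOf
  obtain ⟨κ, hκ, γ, hγ, hγ'⟩ := exists_isCyclotomic_isTopGenerator_isCyclotomicVariable_holds 2
  obtain ⟨D⟩ := W.nonempty_selmerDualData_holds κ γ hγ
  obtain ⟨L, hL⟩ := exists_isMultPAdicLFunctionOf_neg_one_of_nonsplit (p := 2) hf hmult hns
  obtain ⟨hX, -⟩ := hK Dm.f L κ γ hκ hγ hγ' hmult hns hf hL D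
  haveI : Module.Finite (IwasawaAlgebra 2) D.X := D.module_finite_holds hγ
  haveI : (Module.charIdeal (IwasawaAlgebra 2) D.X).IsPrincipal := charIdeal_isPrincipal_holds 2 D.X
  obtain ⟨fE, hchar⟩ := Submodule.IsPrincipal.principal (Module.charIdeal (IwasawaAlgebra 2) D.X)
  have hchar' : D.charIdeal = Ideal.span {fE} := hchar
  -- Greenberg's non-split display at `2` (A235): `f_E(0) ≠ 0` since `Sel` is finite
  have hEC : TwoAdicEulerCharRankZeroNonsplitMult W 0 :=
    twoAdicEulerCharRankZeroNonsplitMult_zero_of_greenberg W h41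
  obtain ⟨u, hu⟩ := hEC hmult hns κ γ hκ hγ hγ' D hX fE hchar' hfin
  have hcard : (Nat.card (W.selmerGroupPInfty 2) : ℚ_[2]) ≠ 0 := by
    haveI := hfin
    exact_mod_cast (Nat.card_pos (α := W.selmerGroupPInfty 2)).ne'
  have hfE0 : ((PowerSeries.constantCoeff fE : ℤ_[2]) : ℚ_[2]) ≠ 0 := by
    intro h0
    rw [h0, zero_mul] at hu
    exact (mul_ne_zero (mul_ne_zero (coe_units_ne_zero 2 u) (zpow_ne_zero _ two_ne_zero)) hcard)
      hu.symm
  -- T-mult-4, non-split clause: `2ⁿ · ι f_E = ι h · L`, constant coefficients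
  obtain ⟨hns', -⟩ := hlow' κ γ hκ hγ hγ' hmult Dm.f hf D fE hchar'
  obtain ⟨n, h, hdiv⟩ := hns' hns L hL
  have h0 := congrArg PowerSeries.constantCoeff hdiv
  rw [map_mul, map_mul, PowerSeries.constantCoeff_C, constantCoeff_iwasawaToPowerSeries,
    constantCoeff_iwasawaToPowerSeries, hL.constantCoeff_of_neg_one] at h0
  -- `2ⁿ · f_E(0) = h(0) · (2 · [0]⁺_f)`, so `[0]⁺_f ≠ 0`
  have hs0 : (ratPlusSymbol Dm.f 0 : ℚ_[2]) ≠ 0 := by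
    intro hz
    rw [hz, mul_zero, mul_zero] at h0
    exact (mul_ne_zero (pow_ne_zero n two_ne_zero) hfE0) h0
  have hs0' : ratPlusSymbol Dm.f 0 ≠ 0 := by exact_mod_cast hs0
  have hL1 : W.entireLFunction 1 ≠ 0 := (ratPlusSymbol_zero_ne_zero_iff W hf).mp hs0'
  exact ⟨hL1, (W.analyticRank_eq_zero_iff_holds hf.hasEntireLFunction).mpr hL1⟩

/-! ## §3 The rank-`0` `2`-converse at a SPLIT `2` (uses Greenberg–Stevens at `2`) -/

/-- **Rank-`0` `2`-converse at a split multiplicative `2` (PROVED modulo the typed input and the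
memo-proved `greenberg_stevens W 2`).** Inputs: Greenberg's split display at `2` (`h41`, A236, PRINT),
modularity, Mahler–Manin (`𝓛₂(E) ≠ 0`, inside), K11b-Rat (`hK`, PROOF-MULT Thm. B — `X` torsion),
T-mult-4 (`hlow'`), and the exceptional-zero formula `greenberg_stevens W 2` (`hGS`, PROOF-GS2). If
`Sel_{2^∞}(E/ℚ)` is finite then `L(E,1) ≠ 0` and `r_an(E) = 0`: A236 gives `f_E(0) ≠ 0`, T-mult-4
(coefficient of `T¹`, `L(0) = 0`) gives `2ⁿ f_E(0) = h(0)·[T¹]L`, so `[T¹]L ≠ 0`, and GS at `2`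
(`[T¹]L·log₂ γ = 𝓛₂(E)·[0]⁺_f`) gives `[0]⁺_f ≠ 0`. [cite: GreenbergLNM1716, §4 pp. 112–113]
[cite: Kobayashi2006DocMath, Cor. 4.2 (shape; odd p)] [cite: MazurTateTeitelbaum1986Invent, §II.10] -/
theorem analyticRank_eq_zero_of_finite_selmer_split_two
    (hGS : greenberg_stevens (W := W) (p := 2))
    (h41 : thm41Analogue_charValue_rankZero_split_baseChange_anyPrime)
    (hmod : nonempty_modularParametrizationData)
    (hK : ∀ [NeZero (W.conductorNorm ℤ)] (f : CuspForm (Gamma0 (W.conductorNorm ℤ)) 2)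
      (L : PowerSeries ℚ_[2]), KatoDivisibilityAtTwoSplitMultRat W f L)
    (hlow' : MultLowerDivisibilityAtTwoRat W)
    (hmult : Mult W 2) (hsp : W.HasSplitMultiplicativeReductionAtPrime 2)
    (hfin : Finite (W.selmerGroupPInfty 2)) :
    W.entireLFunction 1 ≠ 0 ∧ W.analyticRank = 0 := by
  haveI : NeZero (W.conductorNorm ℤ) := ⟨(W.conductorNorm_pos_holds).ne'⟩
  obtain ⟨Dm⟩ := hmod W
  have hf : IsNewformOf W Dm.f := Dm.isNewformOf
  obtain ⟨κ, hκ, γ, hγ, hγ'⟩ := exists_isCyclotomic_isTopGenerator_isCyclotomicVariable_holds 2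
  obtain ⟨D⟩ := W.nonempty_selmerDualData_holds κ γ hγ
  obtain ⟨L, hL⟩ := exists_isSplitMultPAdicLFunctionOf hsp hf
  obtain ⟨Dq⟩ := (nonempty_tateParameterData_iff_holds (W := W) (p := 2)).mpr hsp
  have hlog : padicLog 2 Dq.q ≠ 0 := Dq.padicLog_q_ne_zero Literature.NumberTheory.Transcendental.MahlerManinPadic_holds
  obtain ⟨hX, -⟩ := hK Dm.f L κ γ hκ hγ hγ' hmult hsp hf hL D
  haveI : Module.Finite (IwasawaAlgebra 2) D.X := D.module_finite_holds hγ
  haveI : (Module.charIdeal (IwasawaAlgebra 2) D.X).IsPrincipal := charIdeal_isPrincipal_holds 2 D.X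
  obtain ⟨fE, hchar⟩ := Submodule.IsPrincipal.principal (Module.charIdeal (IwasawaAlgebra 2) D.X)
  have hchar' : D.charIdeal = Ideal.span {fE} := hchar
  -- Greenberg's split display at `2` (A236): `f_E(0) ≠ 0` since `Sel` is finite
  have hEC : TwoAdicEulerCharRankZeroSplitMult W 0 :=
    twoAdicEulerCharRankZeroSplitMult_zero_of_greenberg W h41
  obtain ⟨u, hu⟩ := hEC hmult hsp κ γ hκ hγ hγ' D hX fE hchar' hfin Dq hlog
  have hcard : (Nat.card (W.selmerGroupPInfty 2) : ℚ_[2]) ≠ 0 := by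
    haveI := hfin
    exact_mod_cast (Nat.card_pos (α := W.selmerGroupPInfty 2)).ne'
  have hLI0 : LInvariant Dq ≠ 0 := lInvariant_two_ne_zero W Dq
  have hfE0 : ((PowerSeries.constantCoeff fE : ℤ_[2]) : ℚ_[2]) ≠ 0 := by
    intro h0
    rw [h0, zero_mul] at hu
    refine (mul_ne_zero (mul_ne_zero (mul_ne_zero (coe_units_ne_zero 2 u) ?_)
      (zpow_ne_zero _ two_ne_zero)) hcard) hu.symm
    exact div_ne_zero hLI0 (by norm_num)
  -- T-mult-4, split clause: `2ⁿ · ι(T f_E) = ι h · L`; coefficient of `T¹` (`L(0) = 0`)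
  obtain ⟨-, hsp'⟩ := hlow' κ γ hκ hγ hγ' hmult Dm.f hf D fE hchar'
  obtain ⟨n, h, hdiv⟩ := hsp' hsp L hL
  have h1 := congrArg (PowerSeries.coeff 1) hdiv
  rw [PowerSeries.coeff_C_mul, coeff_one_iwasawaToPowerSeries_X_mul, PowerSeries.coeff_mul,
    Finset.Nat.sum_antidiagonal_eq_sum_range_succ_mk, Finset.sum_range_succ,
    Finset.sum_range_succ, Finset.sum_range_zero, zero_add,
    PowerSeries.coeff_zero_eq_constantCoeff_apply L, hL.constantCoeff_eq_zero, mul_zero, add_zero,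
    PowerSeries.coeff_zero_eq_constantCoeff_apply] at h1
  -- `2ⁿ · f_E(0) = h(0) · [T¹]L`, so `[T¹]L ≠ 0`
  have hc1 : PowerSeries.coeff 1 L ≠ 0 := by
    intro hz
    rw [hz, mul_zero] at h1
    exact (mul_ne_zero (pow_ne_zero n two_ne_zero) hfE0) h1
  -- Greenberg–Stevens at `2`: `[T¹]L · log₂ γ = 𝓛₂(E) · [0]⁺_f`, so `[0]⁺_f ≠ 0`
  obtain ⟨-, hGS1⟩ := hGS Dq hf hL
  have hs0 : (ratPlusSymbol Dm.f 0 : ℚ_[2]) ≠ 0 := by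
    intro hz
    rw [hz, mul_zero] at hGS1
    exact (mul_ne_zero hc1 padicLog_cyclotomicGenerator_two_ne_zero) hGS1
  have hs0' : ratPlusSymbol Dm.f 0 ≠ 0 := by exact_mod_cast hs0
  have hL1 : W.entireLFunction 1 ≠ 0 := (ratPlusSymbol_zero_ne_zero_iff W hf).mp hs0'
  exact ⟨hL1, (W.analyticRank_eq_zero_iff_holds hf.hasEntireLFunction).mpr hL1⟩

end Summit.BirchSwinnertonDyer.Rank1Residual.X5.O1

end
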